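import Literature.MathematicalPhysics.KineticTheory.HardSphereEuler
import HarnessLib

/-!
# Census assembly of the line `pedigree-perpetuity` — the inheritance channel
# (crux `EnergyCurrentTails`, stmt-AtomisticToContinuum-9235)

Support file (`--supports stmt-AtomisticToContinuum-9235`) of the registered stub `stub_censusAssembly`
(lead c3 worker): the HEIR CASCADE + MARKOV bound for the discounted-inheritance channel (I) of the
level inclusion, in abstract form (no lineage objects: terminal carriers `tc i z : Fin N` and terminal
weights `tw i z ∈ [0,1]` are arbitrary a.e.-measurable selections satisfying the cascade
`Σ_{i : tc i z = j} tw i z ≤ 1` on a measurable set `G`).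

Pathwise on `G`, `Σ_i 𝟙{y ≤ ‖(z (tc i z)).2‖² · tw i z} ≤ y⁻¹ Σ_i ‖(z (tc i z)).2‖² 𝟙{y ≤ ‖·‖²} tw i z
= y⁻¹ Σ_j ‖(z j).2‖² 𝟙{y ≤ ‖(z j).2‖²} Σ_{i : tc i z = j} tw i z ≤ y⁻¹ Σ_j ‖(z j).2‖² 𝟙{y ≤ ‖(z j).2‖²}`
(`sum_indicator_inheritance_le`, via `Finset.sum_fiberwise`); integrating (the events are
`P`-null-measurable, so `Σ_i P = ∫⁻ Σ_i 𝟙`) against the tail energy of the data gives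
`Σ_i P({y ≤ ‖(z (tc i z)).2‖² tw i z} ∩ G) ≤ b / y` (`sum_measure_inheritance_le`, main theorem).
-/

noncomputable section

open MeasureTheory Set
open scoped ENNReal BigOperators

namespace Summit.AtomisticToContinuum.HydrodynamicLimit.Theorems.EnergyCurrentTailsPedigree

open Literature.MathematicalPhysics.KineticTheory Literature.Analysis.FluidPDE

variable {N : ℕ}

/-- Joint measurability of the evaluation `(z, k) ↦ ‖(z k).2‖²` (countable second factor). -/
theorem measurable_eval_normSq :
    Measurable fun p : Config N (Fin 3) T3 × Fin N => ‖(p.1 p.2).2‖ ^ 2 :=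
  measurable_from_prod_countable_left fun k =>
    (measurable_snd.comp (measurable_pi_apply k)).norm.pow_const 2

/-- The discounted inheritance `‖(z (tc z)).2‖² · tw z` is a.e.-measurable when the terminal carrier
and weight are. -/
theorem aemeasurable_inheritance (P : Measure (Config N (Fin 3) T3))
    {tc : Config N (Fin 3) T3 → Fin N} {tw : Config N (Fin 3) T3 → ℝ} (htc : AEMeasurable tc P)
    (htw : AEMeasurable tw P) :
    AEMeasurable (fun z => ‖(z (tc z)).2‖ ^ 2 * tw z) P :=
  (measurable_eval_normSq.comp_aemeasurable (aemeasurable_id.prodMk htc)).mul htw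

/-- **Heir cascade, pathwise**: on `G`, with weights in `[0,1]` and the cascade `Σ_{i : tc i z = j} tw i z ≤ 1`,
`Σ_i 𝟙{y ≤ ‖(z (tc i z)).2‖² tw i z} ≤ y⁻¹ Σ_j ‖(z j).2‖² 𝟙{y ≤ ‖(z j).2‖²}` (`y > 0`). -/
theorem sum_indicator_inheritance_le (tc : Fin N → Config N (Fin 3) T3 → Fin N)
    (tw : Fin N → Config N (Fin 3) T3 → ℝ) {y : ℝ} (hy : 0 < y) (z : Config N (Fin 3) T3)
    (hw : ∀ i, 0 ≤ tw i z ∧ tw i z ≤ 1)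
    (hcas : ∀ j, (∑ i ∈ Finset.univ.filter (fun i => tc i z = j), tw i z) ≤ 1) :
    (∑ i : Fin N, if y ≤ ‖(z (tc i z)).2‖ ^ 2 * tw i z then (1 : ℝ) else 0)
      ≤ y⁻¹ * ∑ j : Fin N, Set.indicator {v : V3 | y ≤ ‖v‖ ^ 2} (fun v => ‖v‖ ^ 2) ((z j).2) := by
  -- termwise domination by the discounted seed energy above `y`
  have hterm : ∀ i : Fin N, (if y ≤ ‖(z (tc i z)).2‖ ^ 2 * tw i z then (1 : ℝ) else 0)
      ≤ y⁻¹ * (Set.indicator {v : V3 | y ≤ ‖v‖ ^ 2} (fun v => ‖v‖ ^ 2) ((z (tc i z)).2) * tw i z) := by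
    intro i
    have hind0 : 0 ≤ Set.indicator {v : V3 | y ≤ ‖v‖ ^ 2} (fun v => ‖v‖ ^ 2) ((z (tc i z)).2) :=
      Set.indicator_nonneg (fun v _ => by positivity) _
    split_ifs with h
    · have hE : y ≤ ‖(z (tc i z)).2‖ ^ 2 := by
        refine h.trans ?_
        calc ‖(z (tc i z)).2‖ ^ 2 * tw i z ≤ ‖(z (tc i z)).2‖ ^ 2 * 1 :=
              mul_le_mul_of_nonneg_left (hw i).2 (by positivity)
          _ = _ := mul_one _
      rw [Set.indicator_of_mem (show (z (tc i z)).2 ∈ {v : V3 | y ≤ ‖v‖ ^ 2} from hE),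
        ← div_eq_inv_mul, le_div_iff₀ hy, one_mul]
      exact h
    · exact mul_nonneg (inv_nonneg.2 hy.le) (mul_nonneg hind0 (hw i).1)
  -- fiberwise regrouping by the seed
  have hfib : (∑ i : Fin N, Set.indicator {v : V3 | y ≤ ‖v‖ ^ 2} (fun v => ‖v‖ ^ 2) ((z (tc i z)).2)
        * tw i z)
      = ∑ j : Fin N, Set.indicator {v : V3 | y ≤ ‖v‖ ^ 2} (fun v => ‖v‖ ^ 2) ((z j).2)
          * ∑ i ∈ Finset.univ.filter (fun i => tc i z = j), tw i z := by
    rw [← Finset.sum_fiberwise Finset.univ (fun i => tc i z)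
      (fun i => Set.indicator {v : V3 | y ≤ ‖v‖ ^ 2} (fun v => ‖v‖ ^ 2) ((z (tc i z)).2) * tw i z)]
    refine Finset.sum_congr rfl fun j _ => ?_
    rw [Finset.mul_sum]
    refine Finset.sum_congr rfl fun i hi => ?_
    rw [(Finset.mem_filter.1 hi).2]
  calc (∑ i : Fin N, if y ≤ ‖(z (tc i z)).2‖ ^ 2 * tw i z then (1 : ℝ) else 0)
      ≤ ∑ i : Fin N, y⁻¹ * (Set.indicator {v : V3 | y ≤ ‖v‖ ^ 2} (fun v => ‖v‖ ^ 2) ((z (tc i z)).2)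
          * tw i z) := Finset.sum_le_sum fun i _ => hterm i
    _ = y⁻¹ * ∑ j : Fin N, Set.indicator {v : V3 | y ≤ ‖v‖ ^ 2} (fun v => ‖v‖ ^ 2) ((z j).2)
          * ∑ i ∈ Finset.univ.filter (fun i => tc i z = j), tw i z := by rw [← Finset.mul_sum, hfib]
    _ ≤ y⁻¹ * ∑ j : Fin N, Set.indicator {v : V3 | y ≤ ‖v‖ ^ 2} (fun v => ‖v‖ ^ 2) ((z j).2) * 1 := by
        refine mul_le_mul_of_nonneg_left (Finset.sum_le_sum fun j _ => ?_) (inv_nonneg.2 hy.le)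
        exact mul_le_mul_of_nonneg_left (hcas j) (Set.indicator_nonneg (fun v _ => by positivity) _)
    _ = _ := by simp_rw [mul_one]

/-- **The inheritance channel (heir cascade + Markov + data tail energy).**  For a law `P`, a
measurable set `G`, a.e.-measurable terminal carriers / weights with weights in `[0,1]` and the heir
cascade on `G`, and a tail-energy bound `E_P Σ_l ‖v_l‖² 𝟙{y ≤ ‖v_l‖²} ≤ b` at the level `y > 0`:
`Σ_i P({y ≤ ‖(z (tc i z)).2‖² · tw i z} ∩ G) ≤ b / y`. -/
theorem sum_measure_inheritance_le : ∀ {N : ℕ} (P : Measure (Config N (Fin 3) T3))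
    (G : Set (Config N (Fin 3) T3)) (tc : Fin N → Config N (Fin 3) T3 → Fin N)
    (tw : Fin N → Config N (Fin 3) T3 → ℝ) {y b : ℝ}, 0 < y → 0 ≤ b → MeasurableSet G →
    (∀ i, AEMeasurable (tc i) P) → (∀ i, AEMeasurable (tw i) P) →
    (∀ z ∈ G, ∀ i, 0 ≤ tw i z ∧ tw i z ≤ 1) →
    (∀ z ∈ G, ∀ j, (∑ i ∈ Finset.univ.filter (fun i => tc i z = j), tw i z) ≤ 1) →
    ∫⁻ z, ENNReal.ofReal (∑ l : Fin N, Set.indicator {v : V3 | y ≤ ‖v‖ ^ 2} (fun v => ‖v‖ ^ 2)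
        ((z l).2)) ∂P ≤ ENNReal.ofReal b →
    (∑ i : Fin N, P ({z | y ≤ ‖(z (tc i z)).2‖ ^ 2 * tw i z} ∩ G)) ≤ ENNReal.ofReal (b / y) := by
  intro N P G tc tw y b hy hb hG htc htw hw hcas hdata
  set S : Fin N → Set (Config N (Fin 3) T3) := fun i => {z | y ≤ ‖(z (tc i z)).2‖ ^ 2 * tw i z} ∩ G
    with hS
  have hSm : ∀ i, NullMeasurableSet (S i) P := fun i =>
    ((aemeasurable_inheritance P (htc i) (htw i)).nullMeasurableSet_preimage
      (measurableSet_Ici (a := y))).inter hG.nullMeasurableSet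
  -- pointwise domination of the count of inheritance events
  have hpt : ∀ z, (∑ i : Fin N, (S i).indicator (1 : Config N (Fin 3) T3 → ℝ≥0∞) z)
      ≤ ENNReal.ofReal y⁻¹ * ENNReal.ofReal (∑ l : Fin N,
          Set.indicator {v : V3 | y ≤ ‖v‖ ^ 2} (fun v => ‖v‖ ^ 2) ((z l).2)) := by
    intro z
    by_cases hz : z ∈ G
    · have hind : ∀ i, (S i).indicator (1 : Config N (Fin 3) T3 → ℝ≥0∞) z
          = ENNReal.ofReal (if y ≤ ‖(z (tc i z)).2‖ ^ 2 * tw i z then (1 : ℝ) else 0) := by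
        intro i
        by_cases h : y ≤ ‖(z (tc i z)).2‖ ^ 2 * tw i z
        · rw [Set.indicator_of_mem (show z ∈ S i from ⟨h, hz⟩), if_pos h, ENNReal.ofReal_one]
          rfl
        · rw [Set.indicator_of_notMem (show z ∉ S i from fun h' => h h'.1), if_neg h,
            ENNReal.ofReal_zero]
      simp_rw [hind]
      rw [← ENNReal.ofReal_sum_of_nonneg fun i _ => by positivity,
        ← ENNReal.ofReal_mul (inv_nonneg.2 hy.le)]
      exact ENNReal.ofReal_le_ofReal
        (sum_indicator_inheritance_le tc tw hy z (hw z hz) (hcas z hz))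
    · have h0 : ∀ i, (S i).indicator (1 : Config N (Fin 3) T3 → ℝ≥0∞) z = 0 := fun i =>
        Set.indicator_of_notMem (fun h' => hz h'.2) _
      simp [h0]
  calc (∑ i : Fin N, P (S i))
      = ∑ i : Fin N, ∫⁻ z, (S i).indicator 1 z ∂P :=
        Finset.sum_congr rfl fun i _ => (lintegral_indicator_one₀ (hSm i)).symm
    _ = ∫⁻ z, ∑ i : Fin N, (S i).indicator 1 z ∂P :=
        (lintegral_finsetSum' _ fun i _ => measurable_one.aemeasurable.indicator₀ (hSm i)).symm
    _ ≤ ∫⁻ z, ENNReal.ofReal y⁻¹ * ENNReal.ofReal (∑ l : Fin N,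
          Set.indicator {v : V3 | y ≤ ‖v‖ ^ 2} (fun v => ‖v‖ ^ 2) ((z l).2)) ∂P := lintegral_mono hpt
    _ = ENNReal.ofReal y⁻¹ * ∫⁻ z, ENNReal.ofReal (∑ l : Fin N,
          Set.indicator {v : V3 | y ≤ ‖v‖ ^ 2} (fun v => ‖v‖ ^ 2) ((z l).2)) ∂P :=
        lintegral_const_mul' _ _ ENNReal.ofReal_ne_top
    _ ≤ ENNReal.ofReal y⁻¹ * ENNReal.ofReal b := by gcongr
    _ = ENNReal.ofReal (b / y) := by
        rw [← ENNReal.ofReal_mul (inv_nonneg.2 hy.le), div_eq_inv_mul]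

end Summit.AtomisticToContinuum.HydrodynamicLimit.Theorems.EnergyCurrentTailsPedigree

end
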